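import Literature.Barriers.HodgeConjecture.HodgeLocusAlgebraicOverCurve
import Literature.AlgebraicGeometry.HodgeTheory.VHSDataHodgeLocusOverPuncturedCompactCurve
import Literature.AlgebraicGeometry.HodgeTheory.VHSDataHodgeLocusFiniteCover
import Literature.AlgebraicGeometry.Motives.ZariskiClosedOnPointsDescent
import Literature.AlgebraicGeometry.Motives.FamiliesVHSComapCovering
import Literature.AlgebraicGeometry.FundamentalGroup.RiemannExistenceEtaleLocalHomeomorph
import Mathlib.AlgebraicGeometry.Morphisms.Finite
import HarnessLib

/-!
# The Cattani–Deligne–Kaplan barrier property is checked on a finite (étale) cover: «To prove 1.1 one is free to replace `S` of 1.1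
# by a finite etale covering `S' → S`»

[topic Barriers/HodgeConjecture]

Topic `Literature/Barriers/HodgeConjecture` (namespace `Literature.Barriers.HodgeConjecture`), lane `lit-hodgefound` (seat `p08`, row g56-#3).
THEOREMS ONLY: no definition, NO new named fact (the barrier `CattaniDeligneKaplan1995_hodgeLocus_algebraicFor` is the tree's,
`Barriers/HodgeConjecture/HodgeLocusAlgebraic`), no instance (D-0026 net debt `0`).  SIBLING of
`Barriers/HodgeConjecture/HodgeLocusAlgebraicOverCurve.lean` (§3: over a curve the barrier property is the everything-or-finite dichotomy) and
`…/HodgeLocusAlgebraicOverPuncturedCompactCurve.lean` (the barrier property HOLDS over a punctured compact curve carrying the period charts);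
here the FIRST LINE of the printed proof is delivered: the barrier property of `D` may be verified on the pull-back `g(ℂ)* D` along a finite
surjective (in the source: finite étale) morphism `g : S' ⟶ S`.

PRINTED SOURCE, VERBATIM (E. Cattani, P. Deligne, A. Kaplan, *On the locus of Hodge classes*, J. Amer. Math. Soc. 8 (1995) 483–506; held text
`paper:arxiv-alg-geom_9402009`, p0002): «**Theorem 1.1.** `S^{(K)}` is an algebraic variety, finite over `S`.» «Proof of 1.5 ⟹ 1.1: To prove 1.1
one is free to replace `S` of 1.1 by a finite etale covering `S' → S`. We may and shall assume that the monodromy mod `k` of `𝒱` is trivial, for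
some `k ≥ 3`. Let `S̄` be a smooth compactification of `S`, with `S̄ − S` a divisor with normal crossings. The assumption on the monodromy
ensures that the local monodromy of `𝒱` at infinity is unipotent: in a neighborhood of any point in `S̄ − S`, one is in the situation
considered in 1.5.» (p. 485).

LEAN RENDERING.  `D : GeometricVHSData B f n (2p)` on `S(ℂ)`, `g : S' ⟶ S` a morphism of `ℂ`-schemes, `g(ℂ) = AlgPoints.mapContinuous g :
C(S'(ℂ), S(ℂ))`, and `g(ℂ)* D = D.toVHSData.comap g(ℂ) : VHSData S'(ℂ) (2p)` the pulled-back datum (`Motives/FamiliesVHSComap`; its Hodge locus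
of norm `≤ K` is `g(ℂ)⁻¹` of that of `D`).
* §1 (ANY dimension) **`CattaniDeligneKaplan1995_hodgeLocus_algebraicFor_iff_comap`** — for `g` UNIVERSALLY CLOSED (finite, proper) and
  SURJECTIVE on complex points, `S'`, `S` locally of finite type: **the barrier property of `D` holds iff every Hodge locus of bounded norm of
  `g(ℂ)* D` is Zariski closed on points of `S'`** (`Motives/ZariskiClosedOnPointsDescent`: images of `Z'(ℂ)` under a universally closed `g` are
  `(gZ')(ℂ)`; preimages for the converse); `…_of_comap` (descent) and `…_of_comap_of_isFinite` (the printed hypotheses: `g` finite and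
  surjective); `….comap` (pull-back along any `g`).
* §2 **`CattaniDeligneKaplan1995_hodgeLocus_algebraicFor_of_comap_eq_univ_or_finite`** — for ANY continuous surjection `φ : T → S(ℂ)` (`S`
  locally of finite type): if every Hodge locus of bounded norm of `φ* D` is all of `T` or finite, the barrier property of `D` holds (descent of
  the dichotomy, `Motives/FamiliesVHSComap`, then `…_of_forall_eq_univ_or_finite` of the sibling).
* §3 **`CattaniDeligneKaplan1995_hodgeLocus_algebraicFor_of_charts_of_cover_of_compactification`** — THM 1.1 ∕ COR 1.2 (`r = 1`) AFTER A COVER BY A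
  PUNCTURED COMPACT CURVE: `φ : T → S(ℂ)` continuous surjective (`T` preconnected; `φ = g(ℂ)` for the finite étale covering of the source), and FOR
  `φ* D` the flat interior charts with a metric comparison, the unipotent puncture charts, and the compactification of `T` with disc charts
  (`HodgeTheory/VHSDataHodgeLocusOverPuncturedCompactCurve`; cf. `…/VHSDataHodgeLocusFiniteCover` for the dichotomy itself) ⟹ **`CattaniDeligneKaplan1995_hodgeLocus_algebraicFor
  B D`**.
* §4 **COR 1.3 THROUGH A FINITE ÉTALE COVER** («Let `u` be a section of the local system `𝒱_ℤ` on a universal covering of `S`. The set of points in `S`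
  where some determination of `u` is of type `(0,0)`, is an algebraic subvariety of `S`», p. 484): the determination locus of `u₀` for `D` from
  `g(ℂ)(s'₀)` is the IMAGE under `g(ℂ)` of the determination locus of `u₀` for `g(ℂ)* D` from `s'₀` when `g(ℂ)` is a covering map (path lifting,
  `Motives/FamiliesVHSComapCovering`) — so (ANY dimension) `Motives.VHSData.isZariskiClosedOnPoints_determinationLocus_of_comap_covering` for `g`
  universally closed with `g(ℂ)` a covering map, `isZariskiClosedOnPoints_determinationLocus_of_comap_of_isFinite_of_etale` for `g` FINITE ÉTALE over
  `S` separated (`g(ℂ)` is then a finite covering map: the tree's `FundamentalGroup.isCoveringMap_map_of_isFinite_of_etale_of_isSeparated`, SGA1 XII),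
  and (`r = 1`) `isZariskiClosedOnPoints_determinationLocus_of_cover_of_compactification`: a surjective covering map `φ : T → S(ℂ)` from a punctured
  compact curve carrying the flat charts of Cor. 1.3 for `φ* D` ⟹ the determination locus downstairs is Zariski closed on points
  (`HodgeTheory/VHSDataHodgeLocusFiniteCover` §3).

HONEST SCOPE.  The existence of the finite étale cover with monodromy trivial `mod k ≥ 3` (and `k ≥ 3 ⟹` unipotent local monodromy: the tree's
`GroupTheory/ArithmeticGroups/NeatQuasiUnipotent`), the period charts (holomorphy, Schmid's nilpotent orbit theorem) and the compactification are
HYPOTHESES; étaleness of `g` is not used by the descent (§1–§2 need `g(ℂ)` surjective, §1 also `g` universally closed); §3 and the last form of §4 are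
`dim = 1`.  HC ∕ HC_CM are not touched.

## References

* [CattaniDeligneKaplan1995] E. Cattani, P. Deligne, A. Kaplan, *On the locus of Hodge classes*, J. Amer. Math. Soc. 8 (1995) 483–506: Thm. 1.1,
  Cor. 1.2 (p. 484), «Proof of 1.5 ⟹ 1.1» (p. 485), 2.3 (p. 487).
* [Hartshorne1977] R. Hartshorne, *Algebraic Geometry* (1977), Ch. II Ex. 3.14 (closed points of a scheme of finite type over a field), Ch. II §4
  Ex. 4.1 (finite morphisms are proper).
* [SGA1] A. Grothendieck, M. Raynaud, *Revêtements étales et groupe fondamental* (SGA 1), LNM 224 (1971): Exp. XII Prop. 3.1 (iii), Prop. 3.2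
  (v)–(vi), Thm. 5.1 (a finite étale cover of `X` gives a finite topological cover of `X^an`).
* [Schmid1973] W. Schmid, *Variation of Hodge structure: the singularities of the period mapping*, Invent. Math. 22 (1973): (4.12) (cite only).
-/

noncomputable section

open scoped TensorProduct ComplexOrder
open _root_.Topology _root_.Filter Set
open AlgebraicGeometry

namespace Literature.Barriers.HodgeConjecture

open Literature.AlgebraicGeometry Literature.AlgebraicGeometry.Motives Literature.AlgebraicGeometry.HodgeTheory
open Literature.AlgebraicGeometry.Motives.HodgeStructure (ofRat)

universe u

variable {B : BettiHodgeData ℂ} {𝒳 S S' : SchemeOver ℂ} {f : 𝒳 ⟶ S} {n p : ℕ} (g : S' ⟶ S)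

/-! ## §1 Any dimension: the barrier property is checked on a finite surjective cover -/

/-- **Pull-back**: under the barrier property of `D`, every Hodge locus of bounded norm of the pulled-back datum `g(ℂ)* D` is Zariski closed on
points of `S'` — for ANY morphism `g : S' ⟶ S` (`g(ℂ)⁻¹(Z_K(ℂ)) = (g⁻¹Z_K)(ℂ)`). [cite: CattaniDeligneKaplan1995, Thm. 1.1 and «Proof of 1.5 ⟹ 1.1» (p. 485)] -/
theorem CattaniDeligneKaplan1995_hodgeLocus_algebraicFor.comap {D : GeometricVHSData B f n (2 * p)}
    (h : CattaniDeligneKaplan1995_hodgeLocus_algebraicFor B D) (K : ℤ) :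
    IsZariskiClosedOnPoints S' ((D.toVHSData.comap (AlgPoints.mapContinuous (L := ℂ) g)).hodgeLocusOfNormLe (p : ℤ) K) :=
  D.toVHSData.isZariskiClosedOnPoints_hodgeLocusOfNormLe_comap g (h K)

/-- **DESCENT of the barrier property along a finite surjective cover** («To prove 1.1 one is free to replace `S` of 1.1 by a finite etale covering
`S' → S`»): `g : S' ⟶ S` universally closed (finite, proper) and surjective on complex points, `S'`, `S` locally of finite type over `ℂ`.  If every
Hodge locus of bounded norm of `g(ℂ)* D` is Zariski closed on points of `S'` — Thm. 1.1 ∕ Cor. 1.2 for `g* 𝒱` — then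
**`CattaniDeligneKaplan1995_hodgeLocus_algebraicFor B D`** (each `Hdg-locus_{≤ K}(D) = g(ℂ)(Hdg-locus_{≤ K}(g(ℂ)* D))` is `(g Z'_K)(ℂ)`).
[cite: CattaniDeligneKaplan1995, Thm. 1.1, Cor. 1.2 (p. 484) and «Proof of 1.5 ⟹ 1.1» (p. 485)] [cite: Hartshorne1977, Ch. II §4 Ex. 4.1 and Ch. II Ex. 3.14] -/
theorem CattaniDeligneKaplan1995_hodgeLocus_algebraicFor_of_comap [LocallyOfFiniteType S'.hom] [LocallyOfFiniteType S.hom]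
    [UniversallyClosed g.left] (hsurj : Function.Surjective (AlgPoints.map (L := ℂ) g)) (D : GeometricVHSData B f n (2 * p))
    (h : ∀ K : ℤ, IsZariskiClosedOnPoints S' ((D.toVHSData.comap (AlgPoints.mapContinuous (L := ℂ) g)).hodgeLocusOfNormLe (p : ℤ) K)) :
    CattaniDeligneKaplan1995_hodgeLocus_algebraicFor B D :=
  fun K => D.toVHSData.isZariskiClosedOnPoints_hodgeLocusOfNormLe_of_comap g hsurj (h K)

/-- **The barrier property of `D` holds iff it holds for the pull-back `g(ℂ)* D` on a finite surjective cover** (`g` universally closed and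
surjective on complex points; `S'`, `S` locally of finite type): `∀ K, IsZariskiClosedOnPoints S (Hdg-locus_{≤ K}(D)) ⟺ ∀ K,
IsZariskiClosedOnPoints S' (Hdg-locus_{≤ K}(g(ℂ)* D))`. [cite: CattaniDeligneKaplan1995, Thm. 1.1, Cor. 1.2 (p. 484) and «Proof of 1.5 ⟹ 1.1» (p. 485)]
[cite: Hartshorne1977, Ch. II §4 Ex. 4.1 and Ch. II Ex. 3.14] -/
theorem CattaniDeligneKaplan1995_hodgeLocus_algebraicFor_iff_comap [LocallyOfFiniteType S'.hom] [LocallyOfFiniteType S.hom]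
    [UniversallyClosed g.left] (hsurj : Function.Surjective (AlgPoints.map (L := ℂ) g)) (D : GeometricVHSData B f n (2 * p)) :
    CattaniDeligneKaplan1995_hodgeLocus_algebraicFor B D ↔
      ∀ K : ℤ, IsZariskiClosedOnPoints S' ((D.toVHSData.comap (AlgPoints.mapContinuous (L := ℂ) g)).hodgeLocusOfNormLe (p : ℤ) K) :=
  ⟨fun h K => h.comap g K, CattaniDeligneKaplan1995_hodgeLocus_algebraicFor_of_comap g hsurj D⟩

/-- **The printed hypotheses: `g : S' ⟶ S` FINITE and SURJECTIVE** (a finite étale covering in the source), `S'`, `S` locally of finite type over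
`ℂ`.  A finite morphism is proper, hence universally closed (Mathlib), and a surjective morphism of `ℂ`-schemes locally of finite type is surjective
on complex points (`Motives/ZariskiClosedOnPointsDescent`); so Thm. 1.1 ∕ Cor. 1.2 for `g(ℂ)* D` on `S'` gives the barrier property of `D`.
[cite: CattaniDeligneKaplan1995, «Proof of 1.5 ⟹ 1.1» (p. 485)] [cite: Hartshorne1977, Ch. II §4 Ex. 4.1 and Ch. II Ex. 3.14] -/
theorem CattaniDeligneKaplan1995_hodgeLocus_algebraicFor_of_comap_of_isFinite [LocallyOfFiniteType S'.hom] [LocallyOfFiniteType S.hom]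
    [IsFinite g.left] [Surjective g.left] (D : GeometricVHSData B f n (2 * p))
    (h : ∀ K : ℤ, IsZariskiClosedOnPoints S' ((D.toVHSData.comap (AlgPoints.mapContinuous (L := ℂ) g)).hodgeLocusOfNormLe (p : ℤ) K)) :
    CattaniDeligneKaplan1995_hodgeLocus_algebraicFor B D := fun K =>
  IsZariskiClosedOnPoints.of_preimage_map_of_range_eq_univ g g.left.surjective.range_eq
    (by rw [← D.toVHSData.hodgeLocusOfNormLe_comap_mapContinuous g]; exact h K)

/-! ## §2 From the everything-or-finite dichotomy on a cover -/

/-- **Everything-or-finite on a surjective cover ⟹ the barrier property.**  For ANY continuous SURJECTIVE `φ : T → S(ℂ)` (`S` locally of finite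
type over `ℂ`; e.g. `φ = g(ℂ)` for a finite étale covering `g : S' ⟶ S`): if every Hodge locus of bounded norm of the pull-back `φ* D` is all of
`T` or finite, then every Hodge locus of bounded norm of `D` is all of `S(ℂ)` or finite (images under `φ`), hence Zariski closed on points:
**`CattaniDeligneKaplan1995_hodgeLocus_algebraicFor B D`**. [cite: CattaniDeligneKaplan1995, Thm. 1.1, Cor. 1.2 (p. 484) and «Proof of 1.5 ⟹ 1.1» (p. 485)]
[cite: Hartshorne1977, Ch. II Ex. 3.14] -/
theorem CattaniDeligneKaplan1995_hodgeLocus_algebraicFor_of_comap_eq_univ_or_finite [LocallyOfFiniteType S.hom] {T : Type}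
    [TopologicalSpace T] (φ : C(T, ComplexPoints S)) (hφ : Function.Surjective φ) (D : GeometricVHSData B f n (2 * p))
    (h : ∀ K : ℤ, (D.toVHSData.comap φ).hodgeLocusOfNormLe (p : ℤ) K = univ ∨ ((D.toVHSData.comap φ).hodgeLocusOfNormLe (p : ℤ) K).Finite) :
    CattaniDeligneKaplan1995_hodgeLocus_algebraicFor B D :=
  CattaniDeligneKaplan1995_hodgeLocus_algebraicFor_of_forall_eq_univ_or_finite D fun K =>
    D.toVHSData.hodgeLocusOfNormLe_eq_univ_or_finite_of_comap φ hφ (h K)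

/-! ## §3 Theorem 1.1 / Corollary 1.2 (`r = 1`) after a cover by a punctured compact curve, as the barrier property -/

variable {V : Type u} [AddCommGroup V] [Module ℚ V] [FiniteDimensional ℚ V]
variable {X : Type*} [TopologicalSpace X] [CompactSpace X]

/-- **Cattani–Deligne–Kaplan, THEOREM 1.1 ∕ COROLLARY 1.2 (`r = 1`) AFTER A FINITE ÉTALE COVER BY A PUNCTURED COMPACT CURVE, delivered as the
barrier property.**  `D : GeometricVHSData B f n (2p)` on `S(ℂ)`, `S` locally of finite type over `ℂ`; `φ : T → S(ℂ)` continuous and SURJECTIVE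
with `T` preconnected («replace `S` of 1.1 by a finite etale covering `S' → S`»: `φ = g(ℂ)`, `T = S'(ℂ)`); FOR THE PULL-BACK `φ* D`: flat interior
charts with a uniform Hodge-metric comparison at every point of `T`, unipotent puncture charts `Lᵢ, Γᵢ, Λᵢ, σᵢ, eᵢ, A₀ᵢ` («the local monodromy of
`𝒱` at infinity is unipotent»), and the compactification of `T`: an embedding `j : T → X` into a compact `X` whose complement consists of the
centres `pt i` of disc charts `φc i` with `j (σ i z) = (φc i)⁻¹(e^{2πiz})` («Let `S̄` be a smooth compactification … in a neighborhood of any point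
in `S̄ − S`, one is in the situation considered in 1.5»).  Then **`CattaniDeligneKaplan1995_hodgeLocus_algebraicFor B D`**: every Hodge locus of
bounded norm of `D` is `Z_K(ℂ)` for a Zariski-closed `Z_K ⊆ S` (it is all of `S(ℂ)` or finite).
[cite: CattaniDeligneKaplan1995, Thm. 1.1, Cor. 1.2 (p. 484), «Proof of 1.5 ⟹ 1.1» (p. 485), 2.3 (p. 487)] [cite: Schmid1973, (4.12) (cite only)]
[cite: Hartshorne1977, Ch. II Ex. 3.14] -/
theorem CattaniDeligneKaplan1995_hodgeLocus_algebraicFor_of_charts_of_cover_of_compactification [LocallyOfFiniteType S.hom] {T : Type}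
    [TopologicalSpace T] [PreconnectedSpace T] (φ : C(T, ComplexPoints S)) (hφ : Function.Surjective φ)
    (D : GeometricVHSData B f n (2 * p))
    -- interior charts at every point of the cover
    (hint : ∀ x : T, ∃ ψ : OpenPartialHomeomorph T ℂ, x ∈ ψ.source ∧ IsPreconnected ψ.target ∧
      ∃ (e : ∀ c : ℂ, (D.toVHSData.comap φ).V.fiber (ψ.symm c) ≃ₗ[ℚ] V) (H₀ : HodgeStructure V ((2 * p : ℕ) : ℤ)) (P₀ : H₀.Polarization)
        (h : ℂ → Module.End ℂ (ℂ ⊗[ℚ] V)) (Λ₀ : Submodule ℤ V) (κ : ℝ),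
        (∀ (χ : Module.Dual ℂ (ℂ ⊗[ℚ] V)) (w : ℂ ⊗[ℚ] V), AnalyticOnNhd ℂ (fun c => χ (h c w)) ψ.target) ∧
        (∀ c ∈ ψ.target, (((D.toVHSData.comap φ).hodge (ψ.symm c)).F (p : ℤ)).map ((e c).toLinearMap.baseChange ℂ) =
          (H₀.F (p : ℤ)).comap (h c)) ∧
        (∀ c ∈ ψ.target, ∀ x y : (D.toVHSData.comap φ).V.fiber (ψ.symm c),
          ((D.toVHSData.comap φ).form (ψ.symm c)).form x y = P₀.form (e c x) (e c y)) ∧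
        Λ₀.FG ∧ (∀ c ∈ ψ.target, ∀ u : (D.toVHSData.comap φ).VZ.fiber (ψ.symm c), e c ((D.toVHSData.comap φ).toRat (ψ.symm c) u) ∈ Λ₀) ∧
        (∀ c ∈ ψ.target, ∀ v ∈ Λ₀, ∃ u : (D.toVHSData.comap φ).VZ.fiber (ψ.symm c), e c ((D.toVHSData.comap φ).toRat (ψ.symm c) u) = v) ∧
        0 < κ ∧ (∀ c ∈ ψ.target, ∀ x : (D.toVHSData.comap φ).V.fiber (ψ.symm c),
          κ * P₀.hodgeNorm (ofRat (e c x)) ≤ ((D.toVHSData.comap φ).form (ψ.symm c)).hodgeNorm (ofRat x)))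
    -- puncture charts of the cover (unipotent local monodromy)
    {ι : Type*} (L : ι → PolarizedLimitMixedHodgeStructure V ((2 * p : ℕ) : ℤ)) (Γ : ι → ℂ → Module.End ℂ (ℂ ⊗[ℚ] V))
    (hΓ0 : ∀ i, Γ i 0 = 0) (hΓan : ∀ (i : ι) (χ : Module.Dual ℂ (ℂ ⊗[ℚ] V)) (w : ℂ ⊗[ℚ] V), AnalyticAt ℂ (fun s => χ (Γ i s w)) 0)
    (hΓb : ∀ (i : ι) (s : ℂ), Γ i s ∈ ⨆ ab ∈ {ab : ℤ × ℤ | ab.1 ≤ -1}, (L i).toMixedHodgeStructure.endPiece ab.1 ab.2)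
    (Λ : ι → Submodule ℤ V) (hΛ : ∀ i, (Λ i).FG) (hΛT : ∀ i, ∀ u ∈ Λ i, (L i).monodromy u ∈ Λ i)
    (σ : ι → ℂ → T) (e : ∀ (i : ι) (z : ℂ), (D.toVHSData.comap φ).V.fiber (σ i z) ≃ₗ[ℚ] V) (A₀ : ι → ℝ)
    (hF : ∀ (i : ι) (z : ℂ), A₀ i ≤ z.im → (((D.toVHSData.comap φ).hodge (σ i z)).F (p : ℤ)).map ((e i z).toLinearMap.baseChange ℂ) =
      (((L i).F (p : ℤ)).map (IsNilpotent.exp (Γ i (Complex.exp (2 * Real.pi * Complex.I * z))))).map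
        (IsNilpotent.exp (z • (L i).N.baseChange ℂ)))
    (hQ : ∀ (i : ι) (z : ℂ), A₀ i ≤ z.im → ∀ x y : (D.toVHSData.comap φ).V.fiber (σ i z),
      ((D.toVHSData.comap φ).form (σ i z)).form x y = (L i).Q (e i z x) (e i z y))
    (hΛ₁ : ∀ (i : ι) (z : ℂ), A₀ i ≤ z.im → ∀ u : (D.toVHSData.comap φ).VZ.fiber (σ i z),
      e i z ((D.toVHSData.comap φ).toRat (σ i z) u) ∈ Λ i)
    (hΛ₂ : ∀ (i : ι) (z : ℂ), A₀ i ≤ z.im → ∀ v ∈ Λ i, ∃ u : (D.toVHSData.comap φ).VZ.fiber (σ i z),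
      e i z ((D.toVHSData.comap φ).toRat (σ i z) u) = v)
    -- the compactification of the cover with disc charts at its punctures
    {j : T → X} (hj : IsEmbedding j) (pt : ι → X) (hpS : ∀ i, pt i ∉ range j) (hcov : ∀ x : X, x ∉ range j → ∃ i, x = pt i)
    (φc : ι → OpenPartialHomeomorph X ℂ) (hp : ∀ i, pt i ∈ (φc i).source) (hφp : ∀ i, φc i (pt i) = 0)
    (hball : ∀ i, Metric.ball (0 : ℂ) (Real.exp (-(2 * Real.pi * A₀ i))) ⊆ (φc i).target)
    (hσ : ∀ (i : ι) (z : ℂ), A₀ i < z.im → j (σ i z) = (φc i).symm (Complex.exp (2 * Real.pi * Complex.I * z))) :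
    CattaniDeligneKaplan1995_hodgeLocus_algebraicFor B D :=
  CattaniDeligneKaplan1995_hodgeLocus_algebraicFor_of_comap_eq_univ_or_finite φ hφ D fun K =>
    (D.toVHSData.comap φ).hodgeLocusOfNormLe_eq_univ_or_finite_of_compactification (natCast_add_self_eq_natCast_two_mul p) K hint L Γ hΓ0
      hΓan hΓb Λ hΛ hΛT σ e A₀ hF hQ hΛ₁ hΛ₂ hj pt hpS hcov φc hp hφp hball hσ

/-- **The same for the finite étale covering `g : S' ⟶ S` of the source read on complex points** (`φ = g(ℂ)`, `T = S'(ℂ)` preconnected; `g`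
surjective on complex points — for `g` finite surjective between `ℂ`-schemes locally of finite type this is automatic, §1): everything-or-finite for
every Hodge locus of bounded norm of `g(ℂ)* D` on `S'(ℂ)` (the conclusion of the one-variable Theorem 1.1 for `g(ℂ)* D`, e.g. from the charts of
`…_of_charts_of_cover_of_compactification`) gives the barrier property of `D`. [cite: CattaniDeligneKaplan1995, Thm. 1.1 and «Proof of 1.5 ⟹ 1.1» (p. 485)]
[cite: Hartshorne1977, Ch. II Ex. 3.14] -/
theorem CattaniDeligneKaplan1995_hodgeLocus_algebraicFor_of_map_eq_univ_or_finite [LocallyOfFiniteType S.hom]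
    (hsurj : Function.Surjective (AlgPoints.map (L := ℂ) g)) (D : GeometricVHSData B f n (2 * p))
    (h : ∀ K : ℤ, (D.toVHSData.comap (AlgPoints.mapContinuous (L := ℂ) g)).hodgeLocusOfNormLe (p : ℤ) K = univ ∨
      ((D.toVHSData.comap (AlgPoints.mapContinuous (L := ℂ) g)).hodgeLocusOfNormLe (p : ℤ) K).Finite) :
    CattaniDeligneKaplan1995_hodgeLocus_algebraicFor B D :=
  CattaniDeligneKaplan1995_hodgeLocus_algebraicFor_of_comap_eq_univ_or_finite (AlgPoints.mapContinuous (L := ℂ) g) hsurj D h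

/-! ## §4 Corollary 1.3 through a finite étale cover, as Zariski closedness on points -/

end Literature.Barriers.HodgeConjecture

namespace Literature.AlgebraicGeometry.Motives.VHSData

open Literature.AlgebraicGeometry.Motives

variable {S S' : SchemeOver ℂ} (g : S' ⟶ S) {w : ℤ} (D : VHSData (ComplexPoints S) w)

/-- **The determination locus descends along a cover as an IMAGE** (any dimension): for `g : S' ⟶ S` universally closed (finite, proper) between
`ℂ`-schemes locally of finite type with `g(ℂ)` a COVERING MAP, `s'₀ ∈ S'(ℂ)` and `u₀ ∈ V_ℤ,g(s'₀)`: if the set of `t' ∈ S'(ℂ)` where SOME determination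
`γ' · u₀` (`γ' : s'₀ ⇝ t'`) is of type `(p,p)` for `g(ℂ)* D` is Zariski closed on points of `S'`, then the set of `t ∈ S(ℂ)` where some determination
`γ · u₀` (`γ : g(s'₀) ⇝ t`) is of type `(p,p)` for `D` is Zariski closed on points of `S` — it is the image of the former under `g(ℂ)` (path lifting,
`image_determinationLocus_comap`), and images of `Z'(ℂ)` under a universally closed `g` are `(gZ')(ℂ)` (`IsZariskiClosedOnPoints.image_map`).
[cite: CattaniDeligneKaplan1995, Cor. 1.3 (p. 484) and «Proof of 1.5 ⟹ 1.1» (p. 485)] [cite: Hartshorne1977, Ch. II §4 Ex. 4.1 and Ch. II Ex. 3.14] -/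
theorem isZariskiClosedOnPoints_determinationLocus_of_comap_covering [LocallyOfFiniteType S'.hom] [LocallyOfFiniteType S.hom]
    [UniversallyClosed g.left] (hg : IsCoveringMap (AlgPoints.map (L := ℂ) g)) {p : ℤ} {s'₀ : ComplexPoints S'}
    (u₀ : D.VZ.fiber (AlgPoints.map g s'₀))
    (h : IsZariskiClosedOnPoints S' {t' : ComplexPoints S' | ∃ γ' : Path.Homotopic.Quotient s'₀ t',
      (D.comap (AlgPoints.mapContinuous (L := ℂ) g)).IsHodgeAt t' p ((D.comap (AlgPoints.mapContinuous (L := ℂ) g)).VZ.transport γ' u₀)}) :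
    IsZariskiClosedOnPoints S {t : ComplexPoints S | ∃ γ : Path.Homotopic.Quotient (AlgPoints.map g s'₀) t, D.IsHodgeAt t p (D.VZ.transport γ u₀)} := by
  have himage := D.image_determinationLocus_comap (f := AlgPoints.mapContinuous (L := ℂ) g) hg p s'₀ u₀
  have hZ := h.image_map g
  rw [show (AlgPoints.map (L := ℂ) g '' {t' : ComplexPoints S' | ∃ γ' : Path.Homotopic.Quotient s'₀ t',
      (D.comap (AlgPoints.mapContinuous (L := ℂ) g)).IsHodgeAt t' p ((D.comap (AlgPoints.mapContinuous (L := ℂ) g)).VZ.transport γ' u₀)}) =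
      {t : ComplexPoints S | ∃ γ : Path.Homotopic.Quotient (AlgPoints.map g s'₀) t, D.IsHodgeAt t p (D.VZ.transport γ u₀)} from himage] at hZ
  exact hZ

/-- **The same for `g : S' ⟶ S` FINITE ÉTALE over `S` separated** (`S'`, `S` locally of finite type over `ℂ`): `g(ℂ)` is then a finite covering map
(«un revêtement fini étale de `X` définit un revêtement fini de `X^an`»: the tree's `FundamentalGroup.isCoveringMap_map_of_isFinite_of_etale_of_isSeparated`)
and `g` is proper, so Zariski closedness on points of the determination locus of `u₀` for `g(ℂ)* D` from `s'₀` gives that of the determination locus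
of `u₀` for `D` from `g(s'₀)`. [cite: CattaniDeligneKaplan1995, Cor. 1.3 (p. 484) and «Proof of 1.5 ⟹ 1.1» (p. 485)]
[cite: SGA1, Exp. XII Thm. 5.1 with Prop. 3.1 (iii) and Prop. 3.2 (vi)] -/
theorem isZariskiClosedOnPoints_determinationLocus_of_comap_of_isFinite_of_etale [LocallyOfFiniteType S'.hom] [LocallyOfFiniteType S.hom]
    [IsSeparated S.hom] [IsFinite g.left] [Etale g.left] {p : ℤ} {s'₀ : ComplexPoints S'} (u₀ : D.VZ.fiber (AlgPoints.map g s'₀))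
    (h : IsZariskiClosedOnPoints S' {t' : ComplexPoints S' | ∃ γ' : Path.Homotopic.Quotient s'₀ t',
      (D.comap (AlgPoints.mapContinuous (L := ℂ) g)).IsHodgeAt t' p ((D.comap (AlgPoints.mapContinuous (L := ℂ) g)).VZ.transport γ' u₀)}) :
    IsZariskiClosedOnPoints S {t : ComplexPoints S | ∃ γ : Path.Homotopic.Quotient (AlgPoints.map g s'₀) t, D.IsHodgeAt t p (D.VZ.transport γ u₀)} :=
  D.isZariskiClosedOnPoints_determinationLocus_of_comap_covering g
    (Literature.AlgebraicGeometry.FundamentalGroup.isCoveringMap_map_of_isFinite_of_etale_of_isSeparated g).1 u₀ h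

end Literature.AlgebraicGeometry.Motives.VHSData

namespace Literature.Barriers.HodgeConjecture

open Literature.AlgebraicGeometry Literature.AlgebraicGeometry.Motives Literature.AlgebraicGeometry.HodgeTheory
open Literature.AlgebraicGeometry.Motives.HodgeStructure (ofRat)

universe u

variable {B : BettiHodgeData ℂ} {𝒳 S S' : SchemeOver ℂ} {f : 𝒳 ⟶ S} {n p : ℕ} (g : S' ⟶ S)
variable {V : Type u} [AddCommGroup V] [Module ℚ V] [FiniteDimensional ℚ V]
variable {X : Type*} [TopologicalSpace X] [CompactSpace X]

/-- **Cattani–Deligne–Kaplan, COROLLARY 1.3 (`r = 1`) THROUGH A SURJECTIVE COVERING MAP FROM A PUNCTURED COMPACT CURVE, as Zariski closedness on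
points.**  `D : GeometricVHSData B f n (2p)` on `S(ℂ)`, `S` locally of finite type over `ℂ`; `φ : T → S(ℂ)` a SURJECTIVE COVERING MAP (Mathlib
`IsCoveringMap`; `φ = g(ℂ)` for the finite étale covering `g : S' ⟶ S` of the source, §4 above) with `T` preconnected; `s'₀ ∈ T`, `u₀ ∈ V_ℤ,φ(s'₀)`;
FOR `φ* D` the flat interior charts with a metric comparison, the flat unipotent puncture charts, and the compactification of `T` with disc charts
(the hypotheses of `Motives.VHSData.determinationLocus_eq_univ_or_finite_of_cover_of_compactification`).  Then **the set of `t ∈ S(ℂ)` at which SOME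
determination `γ · u₀` (`γ : φ(s'₀) ⇝ t`) is of type `(p,p)` is the set of complex points of a Zariski-closed subset of `S`** (it is all of `S(ℂ)` or
finite). [cite: CattaniDeligneKaplan1995, Cor. 1.3 (p. 484), «Proof of 1.5 ⟹ 1.1» (p. 485), 2.3 (p. 487)] [cite: Schmid1973, (4.12) (cite only)]
[cite: Hartshorne1977, Ch. II Ex. 3.14] -/
theorem isZariskiClosedOnPoints_determinationLocus_of_cover_of_compactification [LocallyOfFiniteType S.hom] {T : Type} [TopologicalSpace T]
    [PreconnectedSpace T] (φ : C(T, ComplexPoints S)) (hφc : IsCoveringMap φ) (hφ : Function.Surjective φ) (D : GeometricVHSData B f n (2 * p))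
    {s'₀ : T} (u₀ : D.VZ.fiber (φ s'₀))
    -- flat interior charts at every point of the cover
    (hint : ∀ x : T, ∃ ψ : OpenPartialHomeomorph T ℂ, x ∈ ψ.source ∧ IsPreconnected ψ.target ∧
      ∃ (e : ∀ c : ℂ, (D.toVHSData.comap φ).V.fiber (ψ.symm c) ≃ₗ[ℚ] V) (H₀ : HodgeStructure V ((2 * p : ℕ) : ℤ)) (P₀ : H₀.Polarization)
        (h : ℂ → Module.End ℂ (ℂ ⊗[ℚ] V)) (Λ₀ : Submodule ℤ V) (κ : ℝ),
        (∀ (χ : Module.Dual ℂ (ℂ ⊗[ℚ] V)) (w : ℂ ⊗[ℚ] V), AnalyticOnNhd ℂ (fun c => χ (h c w)) ψ.target) ∧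
        (∀ c ∈ ψ.target, (((D.toVHSData.comap φ).hodge (ψ.symm c)).F (p : ℤ)).map ((e c).toLinearMap.baseChange ℂ) =
          (H₀.F (p : ℤ)).comap (h c)) ∧
        Λ₀.FG ∧ (∀ c ∈ ψ.target, ∀ u : (D.toVHSData.comap φ).VZ.fiber (ψ.symm c), e c ((D.toVHSData.comap φ).toRat (ψ.symm c) u) ∈ Λ₀) ∧
        0 < κ ∧ (∀ c ∈ ψ.target, ∀ x : (D.toVHSData.comap φ).V.fiber (ψ.symm c),
          κ * P₀.hodgeNorm (ofRat (e c x)) ≤ ((D.toVHSData.comap φ).form (ψ.symm c)).hodgeNorm (ofRat x)) ∧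
        (∀ c ∈ ψ.target, ∀ c' ∈ ψ.target, ∃ δ : Path.Homotopic.Quotient (ψ.symm c) (ψ.symm c'),
          ∀ y : (D.toVHSData.comap φ).V.fiber (ψ.symm c), e c' ((D.toVHSData.comap φ).V.transport δ y) = e c y))
    -- flat puncture charts of the cover (unipotent local monodromy)
    {ι : Type*} (L : ι → PolarizedLimitMixedHodgeStructure V ((2 * p : ℕ) : ℤ)) (Γ : ι → ℂ → Module.End ℂ (ℂ ⊗[ℚ] V))
    (hΓ0 : ∀ i, Γ i 0 = 0) (hΓan : ∀ (i : ι) (χ : Module.Dual ℂ (ℂ ⊗[ℚ] V)) (w : ℂ ⊗[ℚ] V), AnalyticAt ℂ (fun s => χ (Γ i s w)) 0)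
    (hΓb : ∀ (i : ι) (s : ℂ), Γ i s ∈ ⨆ ab ∈ {ab : ℤ × ℤ | ab.1 ≤ -1}, (L i).toMixedHodgeStructure.endPiece ab.1 ab.2)
    (Λ : ι → Submodule ℤ V) (hΛ : ∀ i, (Λ i).FG) (hΛT : ∀ i, ∀ u ∈ Λ i, (L i).monodromy u ∈ Λ i)
    (σ : ι → ℂ → T) (e : ∀ (i : ι) (z : ℂ), (D.toVHSData.comap φ).V.fiber (σ i z) ≃ₗ[ℚ] V) (A₀ : ι → ℝ)
    (hF : ∀ (i : ι) (z : ℂ), A₀ i ≤ z.im → (((D.toVHSData.comap φ).hodge (σ i z)).F (p : ℤ)).map ((e i z).toLinearMap.baseChange ℂ) =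
      (((L i).F (p : ℤ)).map (IsNilpotent.exp (Γ i (Complex.exp (2 * Real.pi * Complex.I * z))))).map
        (IsNilpotent.exp (z • (L i).N.baseChange ℂ)))
    (hQ : ∀ (i : ι) (z : ℂ), A₀ i ≤ z.im → ∀ x y : (D.toVHSData.comap φ).V.fiber (σ i z),
      ((D.toVHSData.comap φ).form (σ i z)).form x y = (L i).Q (e i z x) (e i z y))
    (hΛ₁ : ∀ (i : ι) (z : ℂ), A₀ i ≤ z.im → ∀ u : (D.toVHSData.comap φ).VZ.fiber (σ i z),
      e i z ((D.toVHSData.comap φ).toRat (σ i z) u) ∈ Λ i)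
    (hflat : ∀ (i : ι) (z z' : ℂ), A₀ i ≤ z.im → A₀ i ≤ z'.im → ∃ δ : Path.Homotopic.Quotient (σ i z) (σ i z'),
      ∀ y : (D.toVHSData.comap φ).V.fiber (σ i z), e i z' ((D.toVHSData.comap φ).V.transport δ y) = e i z y)
    -- the compactification of the cover with disc charts at its punctures
    {j : T → X} (hj : IsEmbedding j) (pt : ι → X) (hpS : ∀ i, pt i ∉ range j) (hcov : ∀ x : X, x ∉ range j → ∃ i, x = pt i)
    (φc : ι → OpenPartialHomeomorph X ℂ) (hp : ∀ i, pt i ∈ (φc i).source) (hφp : ∀ i, φc i (pt i) = 0)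
    (hball : ∀ i, Metric.ball (0 : ℂ) (Real.exp (-(2 * Real.pi * A₀ i))) ⊆ (φc i).target)
    (hσ : ∀ (i : ι) (z : ℂ), A₀ i < z.im → j (σ i z) = (φc i).symm (Complex.exp (2 * Real.pi * Complex.I * z))) :
    IsZariskiClosedOnPoints S
      {t : ComplexPoints S | ∃ γ : Path.Homotopic.Quotient (φ s'₀) t, D.IsHodgeAt t (p : ℤ) (D.VZ.transport γ u₀)} :=
  isZariskiClosedOnPoints_of_eq_univ_or_finite
    (D.toVHSData.determinationLocus_eq_univ_or_finite_of_cover_of_compactification φ hφc hφ (natCast_add_self_eq_natCast_two_mul p) u₀ hint L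
      Γ hΓ0 hΓan hΓb Λ hΛ hΛT σ e A₀ hF hQ hΛ₁ hflat hj pt hpS hcov φc hp hφp hball hσ)

end Literature.Barriers.HodgeConjecture

end
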